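import Literature.MathematicalPhysics.QuantumFieldTheory.Balaban1983to89.B12Rep537

/-!
# Beta / EriceFlowEnclosureB12AsPrintedMarginal — the symmetries of the marginal kernel `B12Rep537.wilsonQ` of (5.36)∕(5.37)
# against the symmetry clauses (5.6)–(5.8) AS TYPED in `B12BetaAsPrinted.Definitions.d121` (β-flow team, prover 1, unit
# `b2b-balaban-beta-bflow-p1`, gen 32; ROW AP-I of the lineage's ENCLOSURE-MAP = [I] AS PRINTED consumed on the recursion ∕ upper ∕
# Theorem-2 side; PART 1 of the orientation audit — PART 2 = `…B12AsPrintedOrientation` (consequences for the interface), the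
# witnesses = `…B12AsPrintedWitness`)

HONEST FRAMING (page 1 of everything the β sub-cell writes): discharging `BetaPertH` makes Bałaban's UV stability UNCONDITIONAL — a
real constructive-QFT result; it is NOT the continuum limit and NOT the Clay problem.  HONEST DEPENDENCY (cell reorg 2026-08-19,
verbatim): «continuum YM on T⁴ ⇐ BetaPertH ∧ nine spine estimates (0/9 proved); BetaPertH ⇐ (D1) ∧ (D4) ∧ CAP+tail; G-an2-4 gates
asym, D1 and NE2/3/4.»  THIS MODULE DISCHARGES NOTHING: it is [folklore] finite-difference algebra on ℤ^d about ONE explicit,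
finitely supported kernel of the tree — `B12Rep537.wilsonQ μ ν = δ_{μν}Σ_κ Δ*_κΔ_κδ₀ − Δ*_μΔ_νδ₀` (`Δ*_μ` = `PeriodicGleason.delta μ`:
`g(x − e_μ) − g(x)`; `Δ_ν` = `B12Rep537.fdelta ν`: `g(x + e_ν) − g(x)`), the kernel the statement-exact typing of [I] = T. Bałaban,
Commun. Math. Phys. **109** (1987) [Balaban1987RG1] (`B12BetaAsPrinted`, typer unit `b2b-balaban-beta-asprinted`, p537882 ✓) subtracts
in its (5.37)∕(5.38) conjunct `Conclusions.c537` («Π_{μν} − β_{j+1}·wilsonQ μ ν = Σ_w D_w Π′_w»).  Nothing of [I] is asserted.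

WHY (the finding this module certifies, kernel level; reported to the typer ∕ row-D4 owner ∕ fit-referees).  `Definitions.d121` types
(1.21)₂ in its ℤ⁴ form (5.6)–(5.8) p. 293 for the kernels Π_{j+1}(g_j; ·): permutation covariance (`B12Beta.PermCovariant`), the
REFLECTIONS (5.7) *"Π_{μν}(εx − (1−ε_μ)∕2 e_μ, εy − (1−ε_ν)∕2 e_ν) = ε_με_νΠ_{μν}(x, y)"* written for the difference variable as
`Π_{μν}(κ ↦ ε_κ z_κ − [κ = μ](1 − ε_μ)∕2 + [κ = ν](1 − ε_ν)∕2) = ε_μ ε_ν Π_{μν}(z)`, and (5.8) `Π_{μν}(z) = Π_{νμ}(−z)`.  Print p. 297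
(quoted in `c537`'s docstring): *"The function Π′_{μν}(p) has all the symmetries of the function Π_{μν}(p)"*.  For that sentence to be
compatible with the typed pair (`d121`, `c537`), the marginal kernel `wilsonQ μ ν` must itself carry the three typed symmetries
whenever β ≠ 0.  THIS FILE PROVES (general dimension d): it carries (5.6) and (5.8) (`wilsonQ_perm`, `wilsonQ_neg_transpose`), it does
NOT carry the typed (5.7) for μ ≠ ν (`wilsonQ_not_reflect`: at ε = (−1 in direction ν), z = 0 the typed reflection point is e_ν,
where Q_{μν} = 0, while ε_με_ν Q_{μν}(0) = 1), and its TRANSPOSE `(μ, ν) ↦ wilsonQ ν μ` (= `wilsonQ μ ν (−·)`) carries all three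
(`wilsonQ_transpose_reflect`).  MECHANISM (§1): off the diagonal `Δ*_μΔ_νδ₀(x) = ([x_μ = 1] − [x_μ = 0])·([x_ν = −1] − [x_ν = 0])·[x = 0
off {μ, ν}]` (`crossQ_eq_prod`) — a BACKWARD pattern in μ times a FORWARD pattern in ν; a backward pattern is odd under
`t ↦ −t + 1`... precisely: the forward pattern `[t = 1] − [t = 0]` is odd under `t ↦ a t + (1 − a)∕2` and the backward pattern
`[t = −1] − [t = 0]` under `t ↦ a t − (1 − a)∕2` (a = −1; `pattern_fwd_reflect`, `pattern_bwd_reflect`), so the typed half-shifts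
(− at μ, + at ν) fit the kernel with the FORWARD pattern in μ and the BACKWARD pattern in ν — `wilsonQ ν μ` — and not `wilsonQ μ ν`.
READING (ours, said once): which of the two clauses is «transposed relative to print» is a Fourier-sign ∕ difference-variable
convention the kernel cannot decide ([I] (5.15): ∂_μ(p) = e^{ip_μ} − 1; `B12Rep537.genFun_wilsonQ` certifies the symbol
δ_{μν}Σ_κ(w_κ − 1)(w_κ⁻¹ − 1) − (w_μ − 1)(w_ν⁻¹ − 1)); what the kernel decides is that, AS TYPED, the two clauses are oriented
oppositely to each other with respect to p. 297's sentence.  PART 2 draws the consequences on the interface (`Definitions S` ⟹ the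
typed Π′ of `c537` violates `d121`'s reflection clause wherever β_{j+1} ≠ 0, keeps the other two, and the transposed reading repairs
it) and shows the antisymmetric part `wilsonQ ν μ − wilsonQ μ ν` is third order in the differences (§3 here: `crossQ_sub_transpose`),
so the typed predicate stays CONSISTENT.

WHAT THIS FILE PROVES (0 sorry, 0 def; [folklore] throughout, general d):
§1 `unitVec_apply`; `dirac_add_eq` (δ₀(x + v) for v supported on {μ, ν}); `ite_and3`; **`crossQ_eq_prod`** (product form of
   Δ*_μΔ_νδ₀, μ ≠ ν); `crossQ_diag_eq` (Δ*_κΔ_κδ₀ = 2[x = 0] − [x = e_κ] − [x = −e_κ]).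
§2 `wilsonQ_offdiag` ∕ `wilsonQ_diag`; `crossQ_neg_transpose`, **`wilsonQ_neg_transpose`** ((5.8)); `unitVec_perm`, `dirac_comp_perm`,
   `crossQ_perm`, **`wilsonQ_perm`** ((5.6)); `sign_mul_self`, `pattern_fwd_reflect`, `pattern_bwd_reflect`, `crossQ_diag_reflect`,
   **`wilsonQ_transpose_reflect`** (the typed (5.7) for `wilsonQ ν μ`, every sign vector, every z), **`wilsonQ_not_reflect`** (its
   failure for `wilsonQ μ ν`, μ ≠ ν).
§3 `fdelta_eq_neg_delta_sub` (Δ_ν = −Δ*_ν − Δ_νΔ*_ν), `delta_delta_comm`, `wilsonQ_transpose_sub`, **`crossQ_sub_transpose`**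
   (`Δ*_μΔ_νδ₀ − Δ*_νΔ_μδ₀ = −Δ*_μΔ_νΔ*_νδ₀ + Δ*_νΔ_μΔ*_μδ₀`: the antisymmetric part of the marginal kernel is a sum of two THIRD-order
   difference words of ∓δ₀).
NOT CLAIMED: anything about Bałaban's Π_{j+1} or (1.22); which convention print intends; `BetaPertH`; continuum; Clay.
-/

namespace Summit.QuantumFields.BalabanUV.Beta.EriceFlowEnclosureB12AsPrintedMarginal

open Literature.MathematicalPhysics.QuantumFieldTheory.GawedzkiKupiainen1985.PeriodicGleason (Pt delta unitVec ExpBound)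
open Literature.MathematicalPhysics.QuantumFieldTheory.Balaban1983to89
open Literature.MathematicalPhysics.QuantumFieldTheory.Balaban1983to89.B12Rep537 (wilsonQ crossQ dirac fdelta crossQ_apply)

noncomputable section

variable {d : ℕ}

/-! ## §1 The marginal kernels as products of one-dimensional patterns -/

/-- Components of the unit vector. [folklore] -/
theorem unitVec_apply (μ κ : Fin d) : unitVec μ κ = if κ = μ then (1 : ℤ) else 0 := rfl

/-- `δ₀(x + v)` for a shift `v` supported on `{μ, ν}` with components `p`, `q` there: the indicator of
`x_μ = −p ∧ x_ν = −q ∧ x = 0 off {μ, ν}`. [folklore] -/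
theorem dirac_add_eq {μ ν : Fin d} {v : Pt d} {p q : ℤ} (hp : v μ = p) (hq : v ν = q)
    (hv : ∀ κ, κ ≠ μ → κ ≠ ν → v κ = 0) (x : Pt d) :
    dirac (x + v) = if (x μ = -p ∧ x ν = -q ∧ ∀ κ, κ ≠ μ → κ ≠ ν → x κ = 0) then 1 else 0 := by
  unfold dirac
  congr 1
  refine propext ⟨fun h => ?_, fun h => ?_⟩
  · have hc : ∀ κ, x κ + v κ = 0 := fun κ => by simpa using congrFun h κ
    refine ⟨by linarith [hc μ], by linarith [hc ν], fun κ h1 h2 => ?_⟩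
    have := hc κ; rw [hv κ h1 h2] at this; linarith
  · funext κ
    simp only [Pi.add_apply, Pi.zero_apply]
    by_cases h1 : κ = μ
    · subst h1; linarith [h.1]
    by_cases h2 : κ = ν
    · subst h2; linarith [h.2.1]
    rw [h.2.2 κ h1 h2, hv κ h1 h2]; simp

/-- Indicator algebra: `[A ∧ B ∧ R] = [A]·[B]·[R]`. [folklore] -/
theorem ite_and3 (A B R : Prop) [Decidable A] [Decidable B] [Decidable R] :
    (if (A ∧ B ∧ R) then (1 : ℂ) else 0) =
      (if A then (1 : ℂ) else 0) * (if B then 1 else 0) * (if R then 1 else 0) := by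
  by_cases hA : A <;> by_cases hB : B <;> by_cases hR : R <;> simp [hA, hB, hR]

/-- **Product form of the off-diagonal cross kernel.**  For `μ ≠ ν`:
`Δ*_μΔ_νδ₀(x) = ([x_μ = 1] − [x_μ = 0])·([x_ν = −1] − [x_ν = 0])·[x = 0 off {μ, ν}]` — the backward pattern in the
μ-coordinate times the forward pattern in the ν-coordinate. [folklore] -/
theorem crossQ_eq_prod {μ ν : Fin d} (hμν : μ ≠ ν) (x : Pt d) :
    crossQ μ ν x =
      (((if x μ = 1 then (1 : ℂ) else 0) - (if x μ = 0 then 1 else 0)) *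
        ((if x ν = -1 then (1 : ℂ) else 0) - (if x ν = 0 then 1 else 0))) *
      (if (∀ κ, κ ≠ μ → κ ≠ ν → x κ = 0) then 1 else 0) := by
  rw [crossQ_apply]
  have hνμ : ν ≠ μ := fun h => hμν h.symm
  rw [dirac_add_eq (μ := μ) (ν := ν) (v := unitVec ν - unitVec μ) (p := -1) (q := 1)
      (by simp [unitVec_apply, hμν]) (by simp [unitVec_apply, hνμ]) (by intro κ a b; simp [unitVec_apply, a, b]),
    dirac_add_eq (μ := μ) (ν := ν) (v := -unitVec μ) (p := -1) (q := 0)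
      (by simp [unitVec_apply]) (by simp [unitVec_apply, hνμ]) (by intro κ a _; simp [unitVec_apply, a]),
    dirac_add_eq (μ := μ) (ν := ν) (v := unitVec ν) (p := 0) (q := 1)
      (by simp [unitVec_apply, hμν]) (by simp [unitVec_apply]) (by intro κ _ b; simp [unitVec_apply, b]),
    dirac_add_eq (μ := μ) (ν := ν) (v := (0 : Pt d)) (p := 0) (q := 0) rfl rfl (fun _ _ _ => rfl)]
  simp only [neg_neg, neg_zero, ite_and3]
  generalize (if (∀ κ, κ ≠ μ → κ ≠ ν → x κ = 0) then (1 : ℂ) else 0) = r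
  ring

/-- **The diagonal cross kernel**: `Δ*_κΔ_κδ₀(x) = 2[x = 0] − [x = e_κ] − [x = −e_κ]`. [folklore] -/
theorem crossQ_diag_eq (κ : Fin d) (x : Pt d) :
    crossQ κ κ x = 2 * (if x = 0 then (1 : ℂ) else 0) - (if x = unitVec κ then 1 else 0) -
      (if x = -unitVec κ then 1 else 0) := by
  rw [crossQ_apply, sub_self, add_zero]
  unfold dirac
  have e1 : (x + -unitVec κ = 0) ↔ x = unitVec κ := by rw [add_eq_zero_iff_eq_neg, neg_neg]
  have e2 : (x + unitVec κ = 0) ↔ x = -unitVec κ := add_eq_zero_iff_eq_neg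
  simp only [e1, e2]
  ring

/-! ## §2 The symmetries of the marginal kernel: permutations, transposition, and the reflections (5.7) AS TYPED -/

/-- Off the diagonal the marginal kernel is minus the cross kernel: `Q_{μν} = −Δ*_μΔ_νδ₀` (`μ ≠ ν`). [cite: Balaban1987RG1, (5.36)–(5.37) p.297] -/
theorem wilsonQ_offdiag {μ ν : Fin d} (hμν : μ ≠ ν) (x : Pt d) : wilsonQ μ ν x = -crossQ μ ν x := by
  simp [wilsonQ, hμν]

/-- On the diagonal: `Q_{κκ} = Σ_λ Δ*_λΔ_λδ₀ − Δ*_κΔ_κδ₀`. [cite: Balaban1987RG1, (5.36)–(5.37) p.297] -/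
theorem wilsonQ_diag (κ : Fin d) (x : Pt d) : wilsonQ κ κ x = ∑ l, crossQ l l x - crossQ κ κ x := by
  simp [wilsonQ]

/-- Transposition law of the cross kernel: `Δ*_νΔ_μδ₀(−x) = Δ*_μΔ_νδ₀(x)`. [folklore] -/
theorem crossQ_neg_transpose (μ ν : Fin d) (x : Pt d) : crossQ ν μ (-x) = crossQ μ ν x := by
  by_cases h : μ = ν
  · subst h
    rw [crossQ_diag_eq, crossQ_diag_eq]
    have e1 : (-x = 0) ↔ x = 0 := neg_eq_zero
    have e2 : (-x = unitVec μ) ↔ x = -unitVec μ := neg_eq_iff_eq_neg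
    have e3 : (-x = -unitVec μ) ↔ x = unitVec μ := neg_inj
    simp only [e1, e2, e3]
    ring
  · have h' : ν ≠ μ := fun e => h e.symm
    rw [crossQ_eq_prod h' (-x), crossQ_eq_prod h x]
    have e1 : ((-x) ν = 1) ↔ x ν = -1 := by rw [Pi.neg_apply]; exact neg_eq_iff_eq_neg
    have e2 : ((-x) ν = 0) ↔ x ν = 0 := by rw [Pi.neg_apply]; exact neg_eq_zero
    have e3 : ((-x) μ = -1) ↔ x μ = 1 := by rw [Pi.neg_apply]; exact neg_inj
    have e4 : ((-x) μ = 0) ↔ x μ = 0 := by rw [Pi.neg_apply]; exact neg_eq_zero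
    have e5 : (∀ κ, κ ≠ ν → κ ≠ μ → (-x) κ = 0) ↔ (∀ κ, κ ≠ μ → κ ≠ ν → x κ = 0) :=
      ⟨fun hh κ a b => by simpa using hh κ b a, fun hh κ a b => by simp [hh κ b a]⟩
    simp only [e1, e2, e3, e4, e5]
    ring

/-- **(5.8), second half, for the marginal kernel**: `Q_{νμ}(−x) = Q_{μν}(x)` — the transposition clause of
`B12BetaAsPrinted.Definitions.d121` holds for `B12Rep537.wilsonQ` (and for its transpose alike). [cite: Balaban1987RG1, (5.8) p.293] -/
theorem wilsonQ_neg_transpose (μ ν : Fin d) (x : Pt d) : wilsonQ ν μ (-x) = wilsonQ μ ν x := by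
  by_cases h : μ = ν
  · subst h
    rw [wilsonQ_diag, wilsonQ_diag]
    simp only [crossQ_neg_transpose]
  · have h' : ν ≠ μ := fun e => h e.symm
    rw [wilsonQ_offdiag h, wilsonQ_offdiag h', crossQ_neg_transpose]

/-- The unit vector of a permuted axis is the permuted unit vector: `e_{σν} = e_ν ∘ σ⁻¹`. [folklore] -/
theorem unitVec_perm (σ : Equiv.Perm (Fin d)) (ν : Fin d) : unitVec (σ ν) = unitVec ν ∘ σ.symm := by
  funext κ
  simp only [unitVec_apply, Function.comp_apply, Equiv.symm_apply_eq]

/-- `δ₀` is invariant under coordinate permutations. [folklore] -/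
theorem dirac_comp_perm (σ : Equiv.Perm (Fin d)) (y : Pt d) : dirac (y ∘ σ.symm) = dirac y := by
  unfold dirac
  congr 1
  refine propext ⟨fun h => ?_, fun h => ?_⟩
  · funext i
    have := congrFun h (σ i)
    simpa using this
  · subst h; rfl

/-- **(5.6) for the cross kernel**: `Δ*_{σμ}Δ_{σν}δ₀(x ∘ σ⁻¹) = Δ*_μΔ_νδ₀(x)` for every permutation σ of the axes. [cite: Balaban1987RG1, (5.6) p.293] -/
theorem crossQ_perm (σ : Equiv.Perm (Fin d)) (μ ν : Fin d) (x : Pt d) :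
    crossQ (σ μ) (σ ν) (x ∘ σ.symm) = crossQ μ ν x := by
  rw [crossQ_apply, crossQ_apply]
  have e : ∀ v : Pt d, (x ∘ σ.symm) + (v ∘ σ.symm) = (x + v) ∘ σ.symm := fun v => rfl
  have n : ∀ v : Pt d, -(v ∘ σ.symm) = (-v) ∘ σ.symm := fun v => rfl
  have s : ∀ v w : Pt d, (v ∘ σ.symm) - (w ∘ σ.symm) = (v - w) ∘ σ.symm := fun v w => rfl
  rw [add_zero, add_zero, unitVec_perm σ μ, unitVec_perm σ ν, s, n, e, e, e,
    dirac_comp_perm, dirac_comp_perm, dirac_comp_perm, dirac_comp_perm]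

/-- **(5.6) for the marginal kernel**: `Q_{σμ,σν}(x ∘ σ⁻¹) = Q_{μν}(x)` — the permutation clause (`B12Beta.PermCovariant`)
of `Definitions.d121` holds for `B12Rep537.wilsonQ` (and for its transpose alike). [cite: Balaban1987RG1, (5.6) p.293] -/
theorem wilsonQ_perm (σ : Equiv.Perm (Fin d)) (μ ν : Fin d) (x : Pt d) :
    wilsonQ (σ μ) (σ ν) (x ∘ σ.symm) = wilsonQ μ ν x := by
  by_cases h : μ = ν
  · subst h
    rw [wilsonQ_diag, wilsonQ_diag, crossQ_perm]
    congr 1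
    calc ∑ l, crossQ l l (x ∘ σ.symm) = ∑ κ, crossQ (σ κ) (σ κ) (x ∘ σ.symm) :=
          (Fintype.sum_equiv σ (fun κ => crossQ (σ κ) (σ κ) (x ∘ σ.symm))
            (fun l => crossQ l l (x ∘ σ.symm)) (fun _ => rfl)).symm
      _ = ∑ κ, crossQ κ κ x := Finset.sum_congr rfl fun κ _ => crossQ_perm σ κ κ x
  · have hσ : σ μ ≠ σ ν := fun e => h (σ.injective e)
    rw [wilsonQ_offdiag h, wilsonQ_offdiag hσ, crossQ_perm]

/-- A sign vector squares to one. [folklore] -/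
theorem sign_mul_self {ε : Fin d → ℤ} (hε : ∀ κ, ε κ = 1 ∨ ε κ = -1) (κ : Fin d) : ε κ * ε κ = 1 := by
  rcases hε κ with h | h <;> simp [h]

/-- One-dimensional reflection of the FORWARD pattern with its half-shift: for `a = ±1`,
`[a t + (1 − a)∕2 = 1] − [a t + (1 − a)∕2 = 0] = a·([t = 1] − [t = 0])`. [folklore] -/
theorem pattern_fwd_reflect {a : ℤ} (ha : a = 1 ∨ a = -1) (t : ℤ) :
    ((if a * t + (1 - a) / 2 = 1 then (1 : ℂ) else 0) - (if a * t + (1 - a) / 2 = 0 then 1 else 0)) =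
      (a : ℂ) * ((if t = 1 then (1 : ℂ) else 0) - (if t = 0 then 1 else 0)) := by
  rcases ha with h | h
  · subst h; simp
  · subst h
    have e1 : (-1 * t + (1 - -1) / 2 = 1) ↔ t = 0 := by omega
    have e2 : (-1 * t + (1 - -1) / 2 = 0) ↔ t = 1 := by omega
    simp only [e1, e2]
    push_cast
    ring

/-- One-dimensional reflection of the BACKWARD pattern with its half-shift: for `a = ±1`,
`[a t − (1 − a)∕2 = −1] − [a t − (1 − a)∕2 = 0] = a·([t = −1] − [t = 0])`. [folklore] -/
theorem pattern_bwd_reflect {a : ℤ} (ha : a = 1 ∨ a = -1) (t : ℤ) :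
    ((if a * t - (1 - a) / 2 = -1 then (1 : ℂ) else 0) - (if a * t - (1 - a) / 2 = 0 then 1 else 0)) =
      (a : ℂ) * ((if t = -1 then (1 : ℂ) else 0) - (if t = 0 then 1 else 0)) := by
  rcases ha with h | h
  · subst h; simp
  · subst h
    have e1 : (-1 * t - (1 - -1) / 2 = -1) ↔ t = 0 := by omega
    have e2 : (-1 * t - (1 - -1) / 2 = 0) ↔ t = -1 := by omega
    simp only [e1, e2]
    push_cast
    ring

/-- Pure sign reflections fix the diagonal cross kernels: `Δ*_λΔ_λδ₀(εz) = Δ*_λΔ_λδ₀(z)`. [folklore] -/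
theorem crossQ_diag_reflect {ε : Fin d → ℤ} (hε : ∀ κ, ε κ = 1 ∨ ε κ = -1) (l : Fin d) (z : Pt d) :
    crossQ l l (fun κ => ε κ * z κ) = crossQ l l z := by
  rw [crossQ_diag_eq, crossQ_diag_eq]
  have hsq := sign_mul_self hε
  have key : ∀ v : Pt d, ((fun κ => ε κ * z κ) = v) ↔ z = fun κ => ε κ * v κ := by
    intro v
    constructor
    · intro h; funext κ
      have hk : ε κ * z κ = v κ := congrFun h κ
      calc z κ = ε κ * ε κ * z κ := by rw [hsq κ, one_mul]
        _ = ε κ * (ε κ * z κ) := by ring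
        _ = ε κ * v κ := by rw [hk]
    · intro h; funext κ
      have hk : z κ = ε κ * v κ := congrFun h κ
      show ε κ * z κ = v κ
      rw [hk, ← mul_assoc, hsq κ, one_mul]
  have v0 : (fun κ => ε κ * (0 : Pt d) κ) = (0 : Pt d) := by funext κ; simp
  rcases hε l with h | h
  · have v1 : (fun κ => ε κ * (unitVec l) κ) = unitVec l := by
      funext κ; by_cases hk : κ = l <;> simp [unitVec_apply, hk, h]
    have v2 : (fun κ => ε κ * (-unitVec l : Pt d) κ) = -unitVec l := by
      funext κ; by_cases hk : κ = l <;> simp [unitVec_apply, hk, h]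
    simp only [key, v0, v1, v2]
  · have v1 : (fun κ => ε κ * (unitVec l) κ) = -unitVec l := by
      funext κ; by_cases hk : κ = l <;> simp [unitVec_apply, hk, h]
    have v2 : (fun κ => ε κ * (-unitVec l : Pt d) κ) = unitVec l := by
      funext κ; by_cases hk : κ = l <;> simp [unitVec_apply, hk, h]
    simp only [key, v0, v1, v2]
    ring

/-- **THE REFLECTIONS (5.7) EXACTLY AS TYPED IN `Definitions.d121` HOLD FOR THE TRANSPOSED MARGINAL KERNEL.**  For every sign
vector ε and every z ∈ ℤ^d: `Q_{νμ}(κ ↦ ε_κ z_κ − [κ = μ](1 − ε_μ)∕2 + [κ = ν](1 − ε_ν)∕2) = ε_μ ε_ν · Q_{νμ}(z)` — i.e. the kernel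
`(μ, ν) ↦ wilsonQ ν μ` satisfies the reflection clause of the as-printed (5.7) (read for the difference variable with the
half-shifts −(1 − ε_μ)∕2 e_μ + (1 − ε_ν)∕2 e_ν).  Mechanism: off the diagonal `Q_{νμ}` is (minus) the FORWARD pattern in the
μ-coordinate times the BACKWARD pattern in the ν-coordinate, and the typed half-shifts are exactly the ones these two patterns
need (`pattern_fwd_reflect`, `pattern_bwd_reflect`); on the diagonal the shifts cancel. [cite: Balaban1987RG1, (5.7) p.293 with (5.36)–(5.37) p.297] -/
theorem wilsonQ_transpose_reflect (μ ν : Fin d) {ε : Fin d → ℤ} (hε : ∀ κ, ε κ = 1 ∨ ε κ = -1) (z : Pt d) :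
    wilsonQ ν μ (fun κ => ε κ * z κ - (if κ = μ then (1 - ε μ) / 2 else 0) + (if κ = ν then (1 - ε ν) / 2 else 0))
      = ((ε μ * ε ν : ℤ) : ℂ) * wilsonQ ν μ z := by
  by_cases h : μ = ν
  · subst h
    have e : (fun κ => ε κ * z κ - (if κ = μ then (1 - ε μ) / 2 else 0) + (if κ = μ then (1 - ε μ) / 2 else 0))
        = fun κ => ε κ * z κ := by funext κ; ring
    rw [e, sign_mul_self hε, wilsonQ_diag, wilsonQ_diag]
    simp only [crossQ_diag_reflect hε, Int.cast_one, one_mul]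
  · have h' : ν ≠ μ := fun e => h e.symm
    rw [wilsonQ_offdiag h', wilsonQ_offdiag h', crossQ_eq_prod h', crossQ_eq_prod h']
    have cν : ε ν * z ν - (if ν = μ then (1 - ε μ) / 2 else 0) + (if ν = ν then (1 - ε ν) / 2 else 0)
        = ε ν * z ν + (1 - ε ν) / 2 := by simp [h']
    have cμ : ε μ * z μ - (if μ = μ then (1 - ε μ) / 2 else 0) + (if μ = ν then (1 - ε ν) / 2 else 0)
        = ε μ * z μ - (1 - ε μ) / 2 := by simp [h]
    have crest : (∀ κ, κ ≠ ν → κ ≠ μ →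
        ε κ * z κ - (if κ = μ then (1 - ε μ) / 2 else 0) + (if κ = ν then (1 - ε ν) / 2 else 0) = 0) ↔
        (∀ κ, κ ≠ ν → κ ≠ μ → z κ = 0) := by
      refine forall_congr' fun κ => ?_
      refine imp_congr_right fun a => imp_congr_right fun b => ?_
      have hk : ε κ ≠ 0 := by rcases hε κ with e | e <;> simp [e]
      simp [a, b, hk]
    rw [cν, cμ, pattern_fwd_reflect (hε ν), pattern_bwd_reflect (hε μ)]
    simp only [crest]
    push_cast
    ring

/-- **… AND FAIL FOR `B12Rep537.wilsonQ μ ν` ITSELF (μ ≠ ν).**  The kernel `(μ, ν) ↦ wilsonQ μ ν` — the one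
`B12BetaAsPrinted.Conclusions.c537` subtracts — does NOT satisfy the reflection clause of `Definitions.d121`: at the sign vector
ε = (−1 in direction ν, +1 elsewhere) and z = 0 the typed reflection point is e_ν, where `Q_{μν}` vanishes, while
ε_μ ε_ν Q_{μν}(0) = (−1)·(−1) = 1.  (Off the diagonal `Q_{μν}` is the BACKWARD pattern in μ times the FORWARD pattern in ν: it
obeys the reflections with the OPPOSITE half-shifts +(1 − ε_μ)∕2 e_μ − (1 − ε_ν)∕2 e_ν.) [cite: Balaban1987RG1, (5.7) p.293 with (5.36)–(5.37) p.297] -/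
theorem wilsonQ_not_reflect {μ ν : Fin d} (hμν : μ ≠ ν) :
    ¬ ∀ ε : Fin d → ℤ, (∀ κ, ε κ = 1 ∨ ε κ = -1) → ∀ z : Pt d,
      wilsonQ μ ν (fun κ => ε κ * z κ - (if κ = μ then (1 - ε μ) / 2 else 0) + (if κ = ν then (1 - ε ν) / 2 else 0))
        = ((ε μ * ε ν : ℤ) : ℂ) * wilsonQ μ ν z := by
  intro hall
  have hνμ : ν ≠ μ := fun e => hμν e.symm
  have hε : ∀ κ, (fun κ : Fin d => if κ = ν then (-1 : ℤ) else 1) κ = 1 ∨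
      (fun κ : Fin d => if κ = ν then (-1 : ℤ) else 1) κ = -1 := by
    intro κ; by_cases hk : κ = ν <;> simp [hk]
  have h := hall (fun κ => if κ = ν then (-1 : ℤ) else 1) hε 0
  have pt : (fun κ : Fin d => (if κ = ν then (-1 : ℤ) else 1) * (0 : Pt d) κ -
      (if κ = μ then (1 - (if μ = ν then (-1 : ℤ) else 1)) / 2 else 0) +
      (if κ = ν then (1 - (if ν = ν then (-1 : ℤ) else 1)) / 2 else 0)) = unitVec ν := by
    funext κ
    by_cases hk : κ = ν
    · subst hk; simp [unitVec_apply, hνμ]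
    · simp [unitVec_apply, hk, hμν]
  rw [pt, wilsonQ_offdiag hμν, wilsonQ_offdiag hμν, crossQ_eq_prod hμν, crossQ_eq_prod hμν] at h
  simp [unitVec_apply, hμν] at h

/-! ## §3 The antisymmetric part of the marginal kernel is third order in the differences -/

/-- The forward difference through the backward one: `Δ_ν g = −Δ*_ν g − Δ_νΔ*_ν g` (all differences commute with each other and with
translations). [folklore] -/
theorem fdelta_eq_neg_delta_sub (ν : Fin d) (g : Pt d → ℂ) (x : Pt d) :
    fdelta ν g x = -(delta ν g x) - fdelta ν (delta ν g) x := by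
  simp only [fdelta, delta, add_sub_cancel_right]
  ring

/-- Backward differences commute: `Δ*_μΔ*_ν = Δ*_νΔ*_μ`. [folklore] -/
theorem delta_delta_comm (μ ν : Fin d) (g : Pt d → ℂ) (x : Pt d) :
    delta μ (delta ν g) x = delta ν (delta μ g) x := by
  simp only [delta]
  rw [sub_right_comm x (unitVec μ) (unitVec ν)]
  ring

/-- `Q_{νμ} − Q_{μν} = Δ*_μΔ_νδ₀ − Δ*_νΔ_μδ₀` (the diagonal parts agree). [cite: Balaban1987RG1, (5.36)–(5.37) p.297] -/
theorem wilsonQ_transpose_sub (μ ν : Fin d) (x : Pt d) :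
    wilsonQ ν μ x - wilsonQ μ ν x = crossQ μ ν x - crossQ ν μ x := by
  by_cases h : μ = ν
  · subst h; simp
  · have h' : ν ≠ μ := fun e => h e.symm
    rw [wilsonQ_offdiag h, wilsonQ_offdiag h']
    ring

/-- **The antisymmetric part of the marginal kernel is THIRD ORDER**:
`Δ*_μΔ_νδ₀ − Δ*_νΔ_μδ₀ = −Δ*_μ(Δ_ν(Δ*_νδ₀)) + Δ*_ν(Δ_μ(Δ*_μδ₀))` — substitute `Δ_ν = −Δ*_ν − Δ_νΔ*_ν` (`fdelta_eq_neg_delta_sub`) in both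
cross kernels; the second-order parts `Δ*_μΔ*_νδ₀`, `Δ*_νΔ*_μδ₀` cancel (`delta_delta_comm`).  Hence replacing `wilsonQ μ ν` by its
transpose in a third-order representation (5.38) only moves two words `D_w(∓δ₀)` into the remainder. [cite: Balaban1987RG1, (5.37)–(5.38) p.297] -/
theorem crossQ_sub_transpose (μ ν : Fin d) (x : Pt d) :
    crossQ μ ν x - crossQ ν μ x =
      -(delta μ (fdelta ν (delta ν dirac)) x) + delta ν (fdelta μ (delta μ dirac)) x := by
  have L : crossQ μ ν x - crossQ ν μ x =
      (fdelta ν dirac (x - unitVec μ) - fdelta ν dirac x) - (fdelta μ dirac (x - unitVec ν) - fdelta μ dirac x) := rfl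
  have R : -(delta μ (fdelta ν (delta ν dirac)) x) + delta ν (fdelta μ (delta μ dirac)) x =
      -(fdelta ν (delta ν dirac) (x - unitVec μ) - fdelta ν (delta ν dirac) x) +
        (fdelta μ (delta μ dirac) (x - unitVec ν) - fdelta μ (delta μ dirac) x) := rfl
  have c : delta ν dirac (x - unitVec μ) - delta ν dirac x = delta μ dirac (x - unitVec ν) - delta μ dirac x :=
    delta_delta_comm μ ν dirac x
  rw [L, R, fdelta_eq_neg_delta_sub ν dirac (x - unitVec μ), fdelta_eq_neg_delta_sub ν dirac x,
    fdelta_eq_neg_delta_sub μ dirac (x - unitVec ν), fdelta_eq_neg_delta_sub μ dirac x]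
  linear_combination -c

end

end Summit.QuantumFields.BalabanUV.Beta.EriceFlowEnclosureB12AsPrintedMarginal
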